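import Literature.NumberTheory.GaloisRepresentations.InertiaHomFrobeniusTwist
import Literature.NumberTheory.GaloisRepresentations.InertiaRootsOfUnity
import Literature.NumberTheory.GaloisRepresentations.ContinuousH1TrivialAction
import Literature.NumberTheory.GaloisRepresentations.ContinuousCorestriction
import Literature.NumberTheory.GaloisRepresentations.AbsGaloisGroupCompact
import Literature.NumberTheory.EllipticCurves.SelmerCocycleLiftUnramifiedFiniteProofs
import HarnessLib

/-!
# The Frobenius acts on `H¹(I_F, A) = Hom_cont(I_F, A)` of an UNRAMIFIED `p`-primary module as
# `q⁻¹ · ρ(φ)` (theorems only)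

Topic `NumberTheory/GaloisRepresentations`; namespace `Literature.NumberTheory.GaloisRepresentations`.
THEOREMS ONLY (no definition, no named fact, no `sorry`). Cell `bsd-stepL`, K2 support 20495
(`JSWSigmaLocalCharIdeal`), step (S5) at the places of GOOD reduction; seat `bsd-stepL-imc-p1` g13.

Let `F` be a non-archimedean local field with residue field of order `q` and characteristic `ℓ`, `p ≠ ℓ` a
prime, `ρ : Γ_F → Aut_{ℤ_p}(A)` continuous on a discrete `p`-primary `A` with finite `A[p^k]` for all `k`,
UNRAMIFIED (`I_F = absInertia F` acts trivially). Then continuous `1`-cocycles of `I_F` in `A` are continuous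
homomorphisms (`ContinuousH1TrivialAction`), they factor through the tame quotient, and conjugation by an
arithmetic Frobenius `φ` multiplies them by `q` (`InertiaHomFrobeniusTwist.apply_conj_eq_pow_nsmul_of_isFrobPow`,
Serre 1972 §1.8 Prop. 6). Consequently the conjugation action `φ·` of the tree (`conjMap`,
`(φ·z)(σ) = ρ(φ) z(φ⁻¹σφ)`) satisfies

* `residueFieldCard_nsmul_apply_conj_eq` — `q • z(φ⁻¹ σ φ) = z(σ)`;
* `residueFieldCard_nsmul_conj_pullback_apply` — **`q • (φ·z)(σ) = ρ(φ)(z(σ))`**, i.e. `φ· = q⁻¹ρ(φ)∘(−)`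
  on `Z¹(I_F, A) = Hom_cont(I_F, A)` ("`H¹(I_v, A) ≅ A(−1)` as a Frobenius module").

This is the input of the characteristic-polynomial computation (S5-good) for the local `Σ`-atom:
on the dual lattice of `H¹(I_w, E[p^∞])`, Frobenius has characteristic polynomial `X² − (a_w/q)X + 1/q`.

## References
* [SerreInventiones1972] J.-P. Serre, Invent. Math. 15 (1972), §1.8 Prop. 6.
* [GreenbergVatsal2000] R. Greenberg, V. Vatsal, Invent. Math. 142 (2000), §2, proof of Prop. 2.4
  (arXiv p. 22: Frob_ℓ on `A_{I_ℓ}(−1)`).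
* [SerreGaloisCohomology1997] J.-P. Serre, *Galois Cohomology* (1997), I §2.3.
-/

noncomputable section

open scoped Classical
open CategoryTheory Function Field ValuativeRel
open Literature.NumberTheory.GaloisRepresentations.IsNonarchimedeanLocalField

universe u

namespace Literature.NumberTheory.GaloisRepresentations

open _root_.TopRep _root_.ContinuousCohomology
open Literature.NumberTheory.EllipticCurves (subgroupConj subgroupConj_apply_coe)

variable (F : Type u) [Field F] [ValuativeRel F] [TopologicalSpace F] [IsNonarchimedeanLocalField F]
variable {p : ℕ} [Fact p.Prime] {A : Type u} [AddCommGroup A] [Module ℤ_[p] A] [TopologicalSpace A]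
  [DiscreteTopology A] [ContinuousSMul ℤ_[p] A]

/-- A finite abelian group killed by `p ^ k`, `p ≠ ℓ` primes, has order prime to `ℓ` (Cauchy). [folklore] -/
private theorem natCard_coprime_of_prime_pow_nsmul_eq_zero {B : Type*} [AddCommGroup B] [Finite B]
    {ℓ : ℕ} (hℓ : ℓ.Prime) (hpℓ : ℓ ≠ p) {k : ℕ} (hB : ∀ b : B, p ^ k • b = 0) :
    (Nat.card B).Coprime ℓ := by
  rw [Nat.Coprime, Nat.gcd_comm]
  refine Nat.coprime_of_dvd fun r hr hrℓ hrB => ?_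
  have hr' : r = ℓ := (Nat.prime_dvd_prime_iff_eq hr hℓ).mp hrℓ
  subst hr'
  haveI : Fact r.Prime := ⟨hr⟩
  obtain ⟨b, hb⟩ := exists_prime_addOrderOf_dvd_card' (G := B) r hrB
  have hdvd : r ∣ p ^ k := by rw [← hb]; exact addOrderOf_dvd_of_nsmul_eq_zero (hB b)
  exact hpℓ ((Nat.prime_dvd_prime_iff_eq hr (Fact.out : p.Prime)).mp (hr.dvd_of_dvd_pow hdvd))

/-- **`q • z(φ⁻¹ σ φ) = z(σ)`** for a continuous `1`-cocycle `z` of the inertia group with values in an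
unramified discrete `p`-primary module (`p ≠` residue characteristic; `A[p^k]` finite for all `k`) and a
Frobenius `φ` (`IsFrobPow φ 1`): `z` is a continuous homomorphism with values in some `A[p^k]`, and
conjugation by `φ` acts on tame homomorphisms as multiplication by `q` (Serre 1972 §1.8 Prop. 6).
[cite: SerreInventiones1972, §1.8 Prop. 6] [cite: SerreGaloisCohomology1997, I §2.3] -/
theorem residueFieldCard_nsmul_apply_conj_eq (ρ : ContinuousRep (absoluteGaloisGroup F) ℤ_[p] A)
    (hℓ : ringChar 𝓀[F] ≠ p) (hA : ∀ a : A, ∃ k : ℕ, p ^ k • a = 0)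
    (hfin : ∀ k : ℕ, Set.Finite {a : A | p ^ k • a = 0})
    (hunr : ∀ σ ∈ absInertia F, ∀ a : A, ρ σ a = a)
    {φ : absoluteGaloisGroup F} (hφ : IsFrobPow φ 1)
    (z : contOneCocycles (subgroupRep ρ.toTopRep (absInertia F))) (σ : absInertia F) :
    residueFieldCard F • z.1 (subgroupConj (absInertia F) φ σ) = z.1 σ := by
  haveI : CompactSpace (absoluteGaloisGroup F) := absoluteGaloisGroup_compactSpace F
  haveI : CompactSpace (absInertia F) :=
    isCompact_iff_compactSpace.mp (isClosed_absInertia_holds F).isCompact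
  -- the cocycle is a homomorphism (trivial action) killed by one power of `p`
  have htriv : ∀ (g : absInertia F) (x : subgroupRep ρ.toTopRep (absInertia F)),
      (subgroupRep ρ.toTopRep (absInertia F)).ρ g x = x := fun g x => hunr g g.2 x
  have hadd := contOneCocycles.apply_mul_of_trivial htriv z
  obtain ⟨k, hk⟩ := Literature.NumberTheory.EllipticCurves.BigGaloisRep.contOneCocycles.exists_pow_smul_apply_eq_zero
    (subgroupRep ρ.toTopRep (absInertia F)) (p : ℤ_[p])
    (fun m => (hA m).imp fun n hn => by rw [← Nat.cast_pow, Nat.cast_smul_eq_nsmul]; exact hn) z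
  have hk' : ∀ g, p ^ k • (z.1 g : A) = 0 := fun g => by
    have := hk g
    rwa [← Nat.cast_pow, Nat.cast_smul_eq_nsmul] at this
  -- the homomorphism `f : I_F → A[p^k]`
  set B : AddSubgroup A := (nsmulAddMonoidHom (p ^ k) : A →+ A).ker with hBdef
  have hmemB : ∀ a : A, a ∈ B ↔ p ^ k • a = 0 := fun a => by
    rw [hBdef, AddMonoidHom.mem_ker, nsmulAddMonoidHom_apply]
  haveI : Finite B := by
    haveI : Finite {a : A | p ^ k • a = 0} := (hfin k).to_subtype
    exact Finite.of_equiv {a : A | p ^ k • a = 0} (Equiv.subtypeEquivRight fun a => (hmemB a).symm)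
  let f : absInertia F → B := fun g => ⟨z.1 g, (hmemB _).mpr (hk' g)⟩
  have hf : ∀ x y, f (x * y) = f x + f y := fun x y => Subtype.ext (hadd x y)
  have hfc : Continuous f := (z.1.continuous).subtype_mk _
  have hB : (Nat.card B).Coprime (ringChar 𝓀[F]) :=
    natCard_coprime_of_prime_pow_nsmul_eq_zero (ringChar_residueField_prime (F := F)) hℓ
      (k := k) fun b => Subtype.ext (by
        rw [AddSubgroupClass.coe_nsmul, ZeroMemClass.coe_zero]; exact (hmemB _).mp b.2)
  -- Serre: `f(φ σ' φ⁻¹) = q • f(σ')` with `σ' = φ⁻¹ σ φ`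
  have hconj : φ * ((subgroupConj (absInertia F) φ σ : absInertia F) : absoluteGaloisGroup F) * φ⁻¹ ∈
      absInertia F := by
    rw [subgroupConj_apply_coe]
    have : φ * (φ⁻¹ * (σ : absoluteGaloisGroup F) * φ) * φ⁻¹ = σ := by group
    rw [this]; exact σ.2
  have key := apply_conj_eq_pow_nsmul_of_isFrobPow F hB f hf hfc hφ (subgroupConj (absInertia F) φ σ) hconj
  have hσ : (⟨φ * ((subgroupConj (absInertia F) φ σ : absInertia F) : absoluteGaloisGroup F) * φ⁻¹, hconj⟩ :
      absInertia F) = σ := Subtype.ext (by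
    change φ * (φ⁻¹ * (σ : absoluteGaloisGroup F) * φ) * φ⁻¹ = σ; group)
  rw [hσ, pow_one] at key
  have := congrArg Subtype.val key
  simpa [f] using this.symm

/-- **`q • (φ·z)(σ) = ρ(φ)(z(σ))`**: on `Z¹(I_F, A) = Hom_cont(I_F, A)` (unramified `p`-primary `A`,
`p ≠` residue characteristic) the conjugation action of a Frobenius `φ` of the tree
(`conjMap`: `(φ·z)(σ) = ρ(φ) z(φ⁻¹σφ)`, `conj_pullback_apply`) is `q⁻¹ · ρ(φ) ∘ (−)` — "`H¹(I_v, A) ≅ A(−1)`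
as a Frobenius module". [cite: GreenbergVatsal2000, §2, proof of Prop. 2.4 (arXiv p. 22: Frob_ℓ on A_{I_ℓ}(−1))]
[cite: SerreInventiones1972, §1.8 Prop. 6] -/
theorem residueFieldCard_nsmul_conj_pullback_apply (ρ : ContinuousRep (absoluteGaloisGroup F) ℤ_[p] A)
    (hℓ : ringChar 𝓀[F] ≠ p) (hA : ∀ a : A, ∃ k : ℕ, p ^ k • a = 0)
    (hfin : ∀ k : ℕ, Set.Finite {a : A | p ^ k • a = 0})
    (hunr : ∀ σ ∈ absInertia F, ∀ a : A, ρ σ a = a)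
    {φ : absoluteGaloisGroup F} (hφ : IsFrobPow φ 1)
    (z : contOneCocycles (subgroupRep ρ.toTopRep (absInertia F))) (σ : absInertia F) :
    residueFieldCard F • (contOneCocycles.pullback (subgroupConj (absInertia F) φ)
        (conjRepHom ρ.toTopRep (absInertia F) φ) z).1 σ = ρ φ (z.1 σ) := by
  rw [conj_pullback_apply, ← map_nsmul]
  exact congrArg _ (residueFieldCard_nsmul_apply_conj_eq F ρ hℓ hA hfin hunr hφ z σ)

end Literature.NumberTheory.GaloisRepresentations

end
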